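import Summits.ABC.IUTFork.Repair.RHCellWeights
import HarnessLib

/-!
# D-0121 (1) T-OPTIMALITY, the LABEL-WEIGHT dimension in CLOSED FORM: over arbitrary label weights the Thm 1.10-type
# chain is extremised by the TOP label alone (ratio `1/(l⋇−1)`), the plain procession average is worse by `3(l⋇+3)/(2l⋇+5) ↓ 3/2`
# (constants `6l(l+5)/((l−3)(l+4)) → 6` vs `4l/(l−3) → 4`), and [IUTchIII] Rmk 3.9.3's hypothesis forces the weights to be uniform

abc-iut cell, rung LADDER-ABC:A2.RESCUE.H; HUMAN D-0121 (21-frontier 2026-08-27T02:09:10Z) question (1) «is the ~j² per-cell weighting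
FORCED for any derivation of a IV-1.10-type height inequality through the Cor 3.12 shape, or does an on-average-over-labels derivation
need strictly less identification mass?»; seat abc-iut-rh2-w-2 (Q1′ WEIGHTS typer 2/2, gen 4; TOPT INPUT line HOME/STATUS.md 02:38:35Z),
owner abc-iut-rh-lead g3 (KICKOFF-1 02:24:50Z; `plan/rescue/R-H/ROUND3/D0121-SPEC.md` v0 §1.3 topt-rf-2 candidate (β) «label-reweighting that
changes the q-side normalisation — is there a typed functional other than PN?» and the lead's ruling ACKS-1 (iii) 02:39:42Z «the LP variables are
CELL weights inside the FIXED procession-normalised functional; a derivation that changes the label NORMALISATION itself has NO typed door today»).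
This file is the ARITHMETIC FENCE for (β): what a non-uniform label normalisation WOULD yield, and why print's own Rmk 3.9.3 pins the uniform one.
PROOF-ONLY (0 definitions, 0 `Prop` facts, no door created): pure label arithmetic over `ℝ`, plus one reading of the tree's
`Literature.IUT.LogThetaLattice.Remark393_equalWeights`. Companion of this lineage's `Repair/RHCellWeights.lean`
(abc-iut-rh2-w-1, p476759/p477616: `sum_fin_sqSubOne` `Σ_{j≤n}(j²−1) = S(n) := n(n−1)(2n+5)/6`, `statement_iff_totalMass_le_excess`).

THE SHAPE BEING PARAMETRISED (print, located not endorsed). [IUTchIV] Thm 1.10 Step (v), p. 28 last display: at `v_ℚ ∈ 𝕍^dst` and label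
`j ∈ {1,…,l⋇}` the weighted-average upper bound for the label-`j` component of the hull log-volume is
  `U_j(v_ℚ) = (j+1)·log(𝔡^K_{v_ℚ}) − (j²/2l)·log(q_{v_ℚ}) + log(𝔰^ℚ_{v_ℚ}) + 4(j+1)·l*_mod·log(𝔰^≤_{v_ℚ})`,
which p. 29 l. 2–7 averages UNIFORMLY over `j` ((E1), (E2)) and Step (viii) compares with `−|log(q)| = −(1/2l)·log(q)`. So the ERROR
side of label `j` weighs `j + 1` (the number of capsule slots `|S^±_{j+1}|`), the GAP side weighs `j² − 1` (Θ-pilot `q^{j²}` against the q-pilot's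
`q^1`; this lineage's demand `d(w,j) = (j²−1)·m_q`), and a hypothetical scheme with label weights `λ = (λ_j)` would derive
`((E_λ[j²] − 1)/2l)·log q ≤ E_λ[j+1]·A + B` (`A` = different + `𝔰^≤` + archimedean `log π` terms, all `∝ j+1` — Steps (v), (vii) p. 28–30;
`B` = the `𝔰^ℚ` term, `j`-free), i.e. a height
inequality with constant `C(λ) = 2l·E_λ[j+1]/(E_λ[j²]−1)` in front of `A`.

WHAT IS PROVED (labels indexed by `i : Fin n`, `j = i + 1`, `n = l⋇`; weights `λ : Fin n → ℝ`, `λ ≥ 0`):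
* §1 `sqSubOne_le_pred_mul_labelSlots` — per label `j² − 1 ≤ (n−1)·(j+1)`, equality iff `j = n`; hence for EVERY weight vector
  `weightedSqSubOne_le` `Σ λ_j (j²−1) ≤ (n−1)·Σ λ_j (j+1)` (the ratio `E_λ[j+1]/(E_λ[j²]−1)` of every scheme is `≥ 1/(n−1)`), with
  `weightedSqSubOne_eq_iff` equality iff `λ` is supported on the top label. So over FREE label weights the programme «minimise the error
  coefficient per unit of gap» is CLOSED-FORM: the top label ALONE is the extremal scheme — no LP is needed in this dimension.
* §2 the three closed forms: TOP `topLabel_gap` / `topLabel_slots` (`n² − 1`, `n + 1`; ratio `1/(n−1)`, `topRatio_eq`); UNIFORM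
  `sum_fin_labelSlots` `Σ_{j≤n}(j+1) = n(n+3)/2`, `uniformRatio_eq` `= 3(n+3)/((n−1)(2n+5))`, and `uniformRatio_eq_mul_topRatio`:
  uniform = `3(n+3)/(2n+5)` × top with `3/2 < 3(n+3)/(2n+5) ≤ 12/7` (`uniform_over_top_bounds`); in `l = 2n+1` currency
  `uniformConstant_eq` `2l·(uniform ratio) = 6l(l+5)/((l−3)(l+4))` (print's `(l+1)/4·(1+4/l)`-against-`(l+1)/24` constant, `> 6`,
  `uniformConstant_gt_six`) and `topConstant_eq` `2l/(n−1) = 4l/(l−3)` (`> 4`, `topConstant_gt_four`).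
* §3 IDENTIFICATION MASS of the top-label scheme in MIN-SLICE §(i)'s (uniform) currency: the top cells carry the fraction
  `(n²−1)/S(n) = 6(n+1)/(n(2n+5)) ≤ 3/n` of the total trivial mass `M` (`topLabel_massFrac_eq`, `topLabel_massFrac_le`) — so over free
  weights the «minimum identification mass that still yields a Thm 1.10-type inequality» is `≍ M/l⋇`, NOT comparable to `T = M − Tol`, and
  it would IMPROVE print's constant `6 → 4`.
* §4 THE DECIDING BIT IS PRINT'S OWN «NO»: [IUTchIII] Rmk 3.9.3 p. 119 l. 59 – p. 120 l. 20 («Is it possible to work with more general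
  weighted averages …? The answer to this question is “no” … one has no choice but to assign the same weights») is the tree's
  `Remark393_equalWeights`; `labelWeights_eq_uniform_of_processionCompatible`: a procession-compatible weight vector of total weight `1`
  IS `λ ≡ 1/n`, and `processionNormalized_eq_uniformWeights`: our `processionNormalized` is exactly that scheme. Hence, AS PRINTED, the
  label-weight programme is a single point and the `~j²` weighting (with its threshold `T`) is forced by the shape; the free-weight optimum
  of §1–§3 is what the shape would give WITHOUT Rmk 3.9.3 — a stronger constant print never claims.

HONEST FRAMING: elementary arithmetic about the displayed per-label bound and OUR typed average; nothing here proves or refutes abc or IUT,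
asserts or denies [IUTchIII] Cor. 3.12 / Rmk. 3.9.3 / [IUTchIV] Thm. 1.10, or takes a side on any author; located ≠ endorsed; typed ≠ proved.
[claim: Mochizuki2012, status: disputed] for every IUT locution. [cite: Mochizuki2012, IUTchIV Thm. 1.10 Step (v) p. 27–29, Step (viii) p. 30;
IUTchIII Prop. 3.9 (i) p. 116, Rmk. 3.9.3 p. 119–120, Cor. 3.12 p. 173–174]
-/

noncomputable section

open Finset

namespace Summit.ABC.IUTFork.Repair.RH.CellWeights

open Literature.IUT.LogThetaLattice

/-! ## §1. Every label-weight scheme: `Σ λ_j (j²−1) ≤ (l⋇−1)·Σ λ_j (j+1)`, equality iff `λ` sits on the top label -/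

section Schemes

variable {n : ℕ}

/-- Per label `j = i+1 ≤ n`: `j² − 1 = (j−1)(j+1) ≤ (n−1)·(j+1)` — the gap weight of a label is at most `l⋇ − 1` times its error
(slot-count) weight. [folklore] -/
theorem sqSubOne_le_pred_mul_labelSlots (i : Fin n) :
    (((i : ℕ) : ℝ) + 1) ^ 2 - 1 ≤ ((n : ℝ) - 1) * ((((i : ℕ) : ℝ) + 1) + 1) := by
  have hi : ((i : ℕ) : ℝ) ≤ (n : ℝ) - 1 := by
    have h := i.2
    have : ((i : ℕ) : ℝ) + 1 ≤ (n : ℝ) := by exact_mod_cast h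
    linarith
  have hpos : (0 : ℝ) ≤ (((i : ℕ) : ℝ) + 1) + 1 := by positivity
  calc (((i : ℕ) : ℝ) + 1) ^ 2 - 1 = ((i : ℕ) : ℝ) * ((((i : ℕ) : ℝ) + 1) + 1) := by ring
    _ ≤ ((n : ℝ) - 1) * ((((i : ℕ) : ℝ) + 1) + 1) := mul_le_mul_of_nonneg_right hi hpos

/-- Equality in `sqSubOne_le_pred_mul_labelSlots` holds EXACTLY at the top label `j = n`. [folklore] -/
theorem sqSubOne_eq_pred_mul_labelSlots_iff (i : Fin n) :
    (((i : ℕ) : ℝ) + 1) ^ 2 - 1 = ((n : ℝ) - 1) * ((((i : ℕ) : ℝ) + 1) + 1) ↔ (i : ℕ) + 1 = n := by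
  have hpos : (0 : ℝ) < (((i : ℕ) : ℝ) + 1) + 1 := by positivity
  constructor
  · intro h
    have h' : (((i : ℕ) : ℝ) - ((n : ℝ) - 1)) * ((((i : ℕ) : ℝ) + 1) + 1) = 0 := by nlinarith [h]
    rcases mul_eq_zero.mp h' with h1 | h1
    · have : ((i : ℕ) : ℝ) + 1 = (n : ℝ) := by linarith
      exact_mod_cast this
    · exact absurd h1 hpos.ne'
  · intro h
    have : ((i : ℕ) : ℝ) + 1 = (n : ℝ) := by exact_mod_cast h
    have hi : ((i : ℕ) : ℝ) = (n : ℝ) - 1 := by linarith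
    rw [hi]; ring

/-- **Every scheme is dominated by the top label.** For ANY nonnegative label weights `λ`:
`Σ_j λ_j·(j²−1) ≤ (n−1)·Σ_j λ_j·(j+1)`, i.e. the error-per-gap ratio `E_λ[j+1]/(E_λ[j²]−1)` of every averaging scheme is `≥ 1/(l⋇−1)`,
the top label's. [folklore] -/
theorem weightedSqSubOne_le (w : Fin n → ℝ) (hw : ∀ i, 0 ≤ w i) :
    ∑ i : Fin n, w i * ((((i : ℕ) : ℝ) + 1) ^ 2 - 1) ≤
      ((n : ℝ) - 1) * ∑ i : Fin n, w i * ((((i : ℕ) : ℝ) + 1) + 1) := by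
  rw [Finset.mul_sum]
  refine Finset.sum_le_sum fun i _ => ?_
  calc w i * ((((i : ℕ) : ℝ) + 1) ^ 2 - 1) ≤ w i * (((n : ℝ) - 1) * ((((i : ℕ) : ℝ) + 1) + 1)) :=
        mul_le_mul_of_nonneg_left (sqSubOne_le_pred_mul_labelSlots i) (hw i)
    _ = ((n : ℝ) - 1) * (w i * ((((i : ℕ) : ℝ) + 1) + 1)) := by ring

/-- **… with equality iff the scheme is the top label alone**: for nonnegative `λ`, equality in `weightedSqSubOne_le` holds iff
`λ_j = 0` for every `j < n`. [folklore] -/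
theorem weightedSqSubOne_eq_iff (w : Fin n → ℝ) (hw : ∀ i, 0 ≤ w i) :
    ∑ i : Fin n, w i * ((((i : ℕ) : ℝ) + 1) ^ 2 - 1) =
        ((n : ℝ) - 1) * ∑ i : Fin n, w i * ((((i : ℕ) : ℝ) + 1) + 1) ↔
      ∀ i : Fin n, (i : ℕ) + 1 ≠ n → w i = 0 := by
  rw [Finset.mul_sum]
  have hle : ∀ i ∈ (Finset.univ : Finset (Fin n)),
      w i * ((((i : ℕ) : ℝ) + 1) ^ 2 - 1) ≤ ((n : ℝ) - 1) * (w i * ((((i : ℕ) : ℝ) + 1) + 1)) := by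
    intro i _
    calc w i * ((((i : ℕ) : ℝ) + 1) ^ 2 - 1) ≤ w i * (((n : ℝ) - 1) * ((((i : ℕ) : ℝ) + 1) + 1)) :=
          mul_le_mul_of_nonneg_left (sqSubOne_le_pred_mul_labelSlots i) (hw i)
      _ = ((n : ℝ) - 1) * (w i * ((((i : ℕ) : ℝ) + 1) + 1)) := by ring
  rw [Finset.sum_eq_sum_iff_of_le hle]
  constructor
  · intro h i hi
    have hpos : (0 : ℝ) < (((i : ℕ) : ℝ) + 1) + 1 := by positivity
    have hlt : (((i : ℕ) : ℝ) + 1) ^ 2 - 1 < ((n : ℝ) - 1) * ((((i : ℕ) : ℝ) + 1) + 1) :=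
      lt_of_le_of_ne (sqSubOne_le_pred_mul_labelSlots i) fun heq => hi ((sqSubOne_eq_pred_mul_labelSlots_iff i).mp heq)
    have hi' := h i (Finset.mem_univ i)
    by_contra hne
    have hwpos : 0 < w i := lt_of_le_of_ne (hw i) (Ne.symm hne)
    have : w i * ((((i : ℕ) : ℝ) + 1) ^ 2 - 1) < ((n : ℝ) - 1) * (w i * ((((i : ℕ) : ℝ) + 1) + 1)) := by
      calc w i * ((((i : ℕ) : ℝ) + 1) ^ 2 - 1) < w i * (((n : ℝ) - 1) * ((((i : ℕ) : ℝ) + 1) + 1)) :=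
            mul_lt_mul_of_pos_left hlt hwpos
        _ = ((n : ℝ) - 1) * (w i * ((((i : ℕ) : ℝ) + 1) + 1)) := by ring
    exact absurd hi' this.ne
  · intro h i _
    by_cases hi : (i : ℕ) + 1 = n
    · rw [(sqSubOne_eq_pred_mul_labelSlots_iff i).mpr hi]; ring
    · rw [h i hi]; ring

end Schemes

/-! ## §2. The three closed forms: top label, uniform (procession) average, their ratio; constants in `l = 2n+1` currency -/

section ClosedForms

variable {n : ℕ}

/-- The top-label scheme's gap weight: `Σ_j [j = n]·(j²−1) = n² − 1`. [folklore] -/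
theorem topLabel_gap (hn : 0 < n) :
    ∑ i : Fin n, (if (i : ℕ) + 1 = n then (1 : ℝ) else 0) * ((((i : ℕ) : ℝ) + 1) ^ 2 - 1) = (n : ℝ) ^ 2 - 1 := by
  rw [Finset.sum_eq_single ⟨n - 1, Nat.sub_lt hn Nat.one_pos⟩]
  · have h : (n - 1 : ℕ) + 1 = n := Nat.sub_add_cancel hn
    simp only [h, if_true, one_mul]
    have : (((n - 1 : ℕ) : ℝ) + 1) = (n : ℝ) := by exact_mod_cast h
    rw [this]
  · intro i _ hi
    have : (i : ℕ) + 1 ≠ n := fun h => hi (Fin.ext (by simp; omega))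
    simp [this]
  · intro h; exact absurd (Finset.mem_univ _) h

/-- The top-label scheme's error (slot) weight: `Σ_j [j = n]·(j+1) = n + 1`. [folklore] -/
theorem topLabel_slots (hn : 0 < n) :
    ∑ i : Fin n, (if (i : ℕ) + 1 = n then (1 : ℝ) else 0) * ((((i : ℕ) : ℝ) + 1) + 1) = (n : ℝ) + 1 := by
  rw [Finset.sum_eq_single ⟨n - 1, Nat.sub_lt hn Nat.one_pos⟩]
  · have h : (n - 1 : ℕ) + 1 = n := Nat.sub_add_cancel hn
    simp only [h, if_true, one_mul]
    have : (((n - 1 : ℕ) : ℝ) + 1) = (n : ℝ) := by exact_mod_cast h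
    rw [this]
  · intro i _ hi
    have : (i : ℕ) + 1 ≠ n := fun h => hi (Fin.ext (by simp; omega))
    simp [this]
  · intro h; exact absurd (Finset.mem_univ _) h

/-- Top-label ratio `(n+1)/(n²−1) = 1/(n−1)` (`n ≥ 2`): in `l = 2n+1` currency the constant `2l/(n−1) = 4l/(l−3) → 4`. [folklore] -/
theorem topRatio_eq (hn : 2 ≤ n) : ((n : ℝ) + 1) / ((n : ℝ) ^ 2 - 1) = 1 / ((n : ℝ) - 1) := by
  have h2 : (2 : ℝ) ≤ n := by exact_mod_cast hn
  have h1 : (n : ℝ) - 1 ≠ 0 := by linarith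
  have h3 : (n : ℝ) + 1 ≠ 0 := by linarith
  have : (n : ℝ) ^ 2 - 1 = ((n : ℝ) - 1) * ((n : ℝ) + 1) := by ring
  rw [this]
  field_simp

/-- `Σ_{i<n} ((i+1)+1) = n(n+3)/2` (range form). [folklore] -/
theorem sum_range_labelSlots (n : ℕ) :
    ∑ i ∈ Finset.range n, ((((i : ℕ) : ℝ) + 1) + 1) = (n : ℝ) * (n + 3) / 2 := by
  induction n with
  | zero => simp
  | succ n ih =>
    rw [Finset.sum_range_succ, ih]
    push_cast
    ring

/-- **Uniform scheme, error side**: `Σ_{j≤n} (j+1) = n(n+3)/2` ([IUTchIV] Step (v) p. 29: `E[j+1] = (l⋇+3)/2 = (l+5)/4`). [folklore] -/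
theorem sum_fin_labelSlots (n : ℕ) :
    ∑ i : Fin n, ((((i : ℕ) : ℝ) + 1) + 1) = (n : ℝ) * (n + 3) / 2 := by
  rw [Fin.sum_univ_eq_sum_range (fun i : ℕ => ((i : ℝ) + 1) + 1) n, sum_range_labelSlots]

/-- **Uniform scheme ratio** `Σ(j+1)/Σ(j²−1) = (n(n+3)/2)/S(n) = 3(n+3)/((n−1)(2n+5))` (`n ≥ 2`; `S(n) = n(n−1)(2n+5)/6`,
`sum_fin_sqSubOne`). [folklore] -/
theorem uniformRatio_eq (hn : 2 ≤ n) :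
    (∑ i : Fin n, ((((i : ℕ) : ℝ) + 1) + 1)) / (∑ i : Fin n, ((((i : ℕ) : ℝ) + 1) ^ 2 - 1)) =
      3 * ((n : ℝ) + 3) / (((n : ℝ) - 1) * (2 * n + 5)) := by
  rw [sum_fin_labelSlots, sum_fin_sqSubOne]
  have h2 : (2 : ℝ) ≤ n := by exact_mod_cast hn
  have h0 : (n : ℝ) ≠ 0 := by linarith
  have h1 : (n : ℝ) - 1 ≠ 0 := by linarith
  have h5 : (2 : ℝ) * n + 5 ≠ 0 := by linarith
  field_simp
  ring

/-- **Uniform = `3(n+3)/(2n+5)` × top**: `3(n+3)/((n−1)(2n+5)) = (3(n+3)/(2n+5))·(1/(n−1))`. [folklore] -/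
theorem uniformRatio_eq_mul_topRatio (hn : 2 ≤ n) :
    3 * ((n : ℝ) + 3) / (((n : ℝ) - 1) * (2 * n + 5)) = (3 * ((n : ℝ) + 3) / (2 * n + 5)) * (1 / ((n : ℝ) - 1)) := by
  have h2 : (2 : ℝ) ≤ n := by exact_mod_cast hn
  have h1 : (n : ℝ) - 1 ≠ 0 := by linarith
  have h5 : (2 : ℝ) * n + 5 ≠ 0 := by linarith
  field_simp

/-- The uniform/top factor lies in `(3/2, 12/7]` for every `n ≥ 1` and decreases to `3/2`: the plain procession average pays `≥ 3/2`
times the top label's error per unit of gap (constants `6` vs `4` in the limit). [folklore] -/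
theorem uniform_over_top_bounds (hn : 1 ≤ n) :
    (3 : ℝ) / 2 < 3 * ((n : ℝ) + 3) / (2 * n + 5) ∧ 3 * ((n : ℝ) + 3) / (2 * n + 5) ≤ 12 / 7 := by
  have h1 : (1 : ℝ) ≤ n := by exact_mod_cast hn
  have h5 : (0 : ℝ) < 2 * n + 5 := by linarith
  constructor
  · rw [div_lt_div_iff₀ (by norm_num) h5]; linarith
  · rw [div_le_div_iff₀ h5 (by norm_num)]; linarith

/-- **Print's constant from the uniform average, `l`-currency** (`l = 2n+1`): `2l·3(n+3)/((n−1)(2n+5)) = 6l(l+5)/((l−3)(l+4))`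
(= `(l+1)/4·(1+4/l)` against `(l+1)/24`, up to print's roundings `1/(l+1) ≤ 1/l`, `4(l+5)/(l+1) ≤ 20/3`). [folklore] -/
theorem uniformConstant_eq (hn : 2 ≤ n) :
    2 * (2 * (n : ℝ) + 1) * (3 * ((n : ℝ) + 3) / (((n : ℝ) - 1) * (2 * n + 5))) =
      6 * (2 * (n : ℝ) + 1) * ((2 * (n : ℝ) + 1) + 5) / (((2 * (n : ℝ) + 1) - 3) * ((2 * (n : ℝ) + 1) + 4)) := by
  have h2 : (2 : ℝ) ≤ n := by exact_mod_cast hn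
  have h1 : (n : ℝ) - 1 ≠ 0 := by linarith
  have h5 : (2 : ℝ) * n + 5 ≠ 0 := by linarith
  have h3 : (2 * (n : ℝ) + 1) - 3 ≠ 0 := by linarith
  have h4 : (2 * (n : ℝ) + 1) + 4 ≠ 0 := by linarith
  field_simp
  ring

/-- The uniform constant exceeds `6` at every `l = 2n+1 ≥ 5`: `6l(l+5) > 6(l−3)(l+4)`. [folklore] -/
theorem uniformConstant_gt_six (hn : 2 ≤ n) :
    (6 : ℝ) < 6 * (2 * (n : ℝ) + 1) * ((2 * (n : ℝ) + 1) + 5) / (((2 * (n : ℝ) + 1) - 3) * ((2 * (n : ℝ) + 1) + 4)) := by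
  have h2 : (2 : ℝ) ≤ n := by exact_mod_cast hn
  have hpos : (0 : ℝ) < ((2 * (n : ℝ) + 1) - 3) * ((2 * (n : ℝ) + 1) + 4) := by nlinarith
  rw [lt_div_iff₀ hpos]
  nlinarith

/-- **Top-label constant, `l`-currency**: `2l/(n−1) = 4l/(l−3)` with `l = 2n+1`. [folklore] -/
theorem topConstant_eq (hn : 2 ≤ n) :
    2 * (2 * (n : ℝ) + 1) * (1 / ((n : ℝ) - 1)) = 4 * (2 * (n : ℝ) + 1) / ((2 * (n : ℝ) + 1) - 3) := by
  have h2 : (2 : ℝ) ≤ n := by exact_mod_cast hn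
  have h1 : (n : ℝ) - 1 ≠ 0 := by linarith
  have h3 : (2 * (n : ℝ) + 1) - 3 ≠ 0 := by linarith
  field_simp
  ring

/-- The top-label constant exceeds `4` at every `l = 2n+1 ≥ 5` (and tends to `4`): `4l > 4(l−3)`. [folklore] -/
theorem topConstant_gt_four (hn : 2 ≤ n) :
    (4 : ℝ) < 4 * (2 * (n : ℝ) + 1) / ((2 * (n : ℝ) + 1) - 3) := by
  have h2 : (2 : ℝ) ≤ n := by exact_mod_cast hn
  have hpos : (0 : ℝ) < (2 * (n : ℝ) + 1) - 3 := by linarith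
  rw [lt_div_iff₀ hpos]
  linarith

end ClosedForms

/-! ## §3. Identification mass of the top-label scheme in the uniform (MIN-SLICE §(i)) currency -/

section TopMass

variable {n : ℕ}

/-- **Top cells carry `(n²−1)/S(n) = 6(n+1)/(n(2n+5))` of the total trivial mass** (`S(n) = Σ_{j≤n}(j²−1)`, `sum_fin_sqSubOne`;
MIN-SLICE (i-w2).2: 48 % at `l = 11`, 41 % at `13`, 19.5 % at `29`). [folklore] -/
theorem topLabel_massFrac_eq (hn : 2 ≤ n) :
    ((n : ℝ) ^ 2 - 1) / (∑ i : Fin n, ((((i : ℕ) : ℝ) + 1) ^ 2 - 1)) = 6 * ((n : ℝ) + 1) / ((n : ℝ) * (2 * n + 5)) := by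
  rw [sum_fin_sqSubOne]
  have h2 : (2 : ℝ) ≤ n := by exact_mod_cast hn
  have h0 : (n : ℝ) ≠ 0 := by linarith
  have h1 : (n : ℝ) - 1 ≠ 0 := by linarith
  have h5 : (2 : ℝ) * n + 5 ≠ 0 := by linarith
  have : (n : ℝ) ^ 2 - 1 = ((n : ℝ) - 1) * ((n : ℝ) + 1) := by ring
  rw [this]
  field_simp

/-- … which is `≤ 3/n = 3/l⋇`: over free label weights the extremal scheme needs identification mass `≍ M/l⋇`, not `≍ M`. [folklore] -/
theorem topLabel_massFrac_le (hn : 2 ≤ n) :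
    6 * ((n : ℝ) + 1) / ((n : ℝ) * (2 * n + 5)) ≤ 3 / (n : ℝ) := by
  have h2 : (2 : ℝ) ≤ n := by exact_mod_cast hn
  have h0 : (0 : ℝ) < n := by linarith
  have h5 : (0 : ℝ) < (n : ℝ) * (2 * n + 5) := by positivity
  rw [div_le_div_iff₀ h5 h0]
  nlinarith

end TopMass

/-! ## §4. [IUTchIII] Rmk 3.9.3's hypothesis forces the uniform scheme; `processionNormalized` IS the uniform scheme -/

section Forced

variable {n : ℕ}

/-- **Rmk 3.9.3 ⇒ `λ ≡ 1/l⋇`.** A label-weight vector that is procession-compatible in the sense typed by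
`Literature.IUT.LogThetaLattice.Remark393_equalWeights` (any two capsules sharing a label carry the same weight) and has total weight `1`
is the uniform vector. So, AS PRINTED, the label-weight dimension of the T-optimality programme is a single point.
[claim: Mochizuki2012, status: disputed] -/
theorem labelWeights_eq_uniform_of_processionCompatible (c : Fin n → ℝ)
    (h : ∀ (j' : ℕ) (j₁ j₂ : Fin n), j' ≤ j₁ → j' ≤ j₂ → c j₁ = c j₂) (hsum : ∑ j : Fin n, c j = 1) (j : Fin n) :
    c j = 1 / (n : ℝ) := by
  have hconst : ∀ j' : Fin n, c j' = c j := fun j' => Remark393_equalWeights c h j' j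
  have hs : ∑ j' : Fin n, c j' = (n : ℝ) * c j := by
    rw [Finset.sum_congr rfl fun j' _ => hconst j', Finset.sum_const, Finset.card_univ, Fintype.card_fin, nsmul_eq_mul]
  have hn : (n : ℝ) ≠ 0 := by
    intro h0
    rw [hs, h0, zero_mul] at hsum
    exact zero_ne_one hsum
  rw [hs] at hsum
  field_simp
  linarith

/-- **Our `PN` is the uniform scheme**: `processionNormalized vol = Σ_j (1/l⋇)·vol_j` ([IUTchIII] Prop. 3.9 (i): the plain average over
the capsules of the procession). [claim: Mochizuki2012, status: disputed] -/
theorem processionNormalized_eq_uniformWeights (vol : Fin n → ℝ) :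
    processionNormalized vol = ∑ j : Fin n, (1 / (n : ℝ)) * vol j := by
  unfold processionNormalized
  rw [← Finset.mul_sum]
  ring

/-- Hence under Rmk 3.9.3's hypothesis every admissible weighted average of label volumes IS `processionNormalized`.
[claim: Mochizuki2012, status: disputed] -/
theorem weightedSum_eq_processionNormalized_of_processionCompatible (c : Fin n → ℝ)
    (h : ∀ (j' : ℕ) (j₁ j₂ : Fin n), j' ≤ j₁ → j' ≤ j₂ → c j₁ = c j₂) (hsum : ∑ j : Fin n, c j = 1) (vol : Fin n → ℝ) :
    ∑ j : Fin n, c j * vol j = processionNormalized vol := by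
  rw [processionNormalized_eq_uniformWeights]
  exact Finset.sum_congr rfl fun j _ => by rw [labelWeights_eq_uniform_of_processionCompatible c h hsum j]

end Forced

end Summit.ABC.IUTFork.Repair.RH.CellWeights

end
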